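import Summits.Ventures.HSemireg.WedgeHankelClassSpaceIrreducible
import Summits.Ventures.HSemireg.WedgeHankelSiegelClassesStable
import Mathlib.LinearAlgebra.Eigenspace.Minpoly

/-!
# Venture HSemireg — THE SHARP IRREDUCIBILITY CRITERION FOR TH-7's CLASS SPACE IN EVERY CHARACTERISTIC: over a field with an element `t` of multiplicative order `> n`,
# the class space `spikeSpan n` is irreducible under the substitutions IFF every binomial coefficient `C(n,j)` is a unit in `K` — «if» by the torus `SbC(1 0 0 t)`
# (whose Lagrange projectors put every spike component of a stable subspace back into it), the shear and the swap; «only if» by the Siegel classes (J8)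

HONEST FRAMING. Part of the Lean index of the computation cell `pub-hsemireg` (seat p10 gen 21, Sunday typer «UNIFORM-IN-n»).
Finite-dimensional EXTERIOR ALGEBRA + linear algebra ONLY: no variety, no cohomology theory, no sheaf, no Ext group, no semiregularity map;
nothing here says that HC / HC_CM / HC_AV holds; no Literature fact is declared or used.  Custodian versions as in `WedgeHankelSiegelIdeal` (1/3) and `WedgeHankelFrameChange`;
the dictionary (the class space = `Sym^n` of the letters' plane; in characteristic `p` it is an irreducible `GL₂`-module iff `n + 1 = (d+1)p^k`, `d < p`, i.e. iff no
`C(n,j)` vanishes — then `Sym^n = St_k ⊗ L(d)^{[k]}`) is QUOTED, never asserted.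

WHAT IS IN THE TREE.  J9 (`WedgeHankelClassSpaceIrreducible`): `eq_top_of_shear_swap_stable` — irreducible under `SbC(1 1 0 1)`, `SbC(0 1 1 0)` when `n! ≠ 0` (characteristic `0`
or `p > n`), `pow_apply_mem_of_forall_mem`, `SbC_swap_spike_top`; J8 (`WedgeHankelSiegelClassesStable`): the Siegel classes `coSiegel_n ⊓ SI_n` are `Sb`-stable and proper;
I19 `coSiegel_inf_siegelIdeal_eq_bot_iff` (`= ⊥ ⇔` all `C(n,j)` units), `w_spike_zero_not_mem_siegelIdeal`; I4 `Sb_diag_w_spike` (the spikes are the weight vectors of the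
torus); I11 `toMatrix_SbC`, I1 `sbMat_shear_apply`.  J9's docstring leaves OPEN the sharp criterion for `p ≤ n` (gen-20 OPEN (b)).  THIS FILE (namespace
`Summit.Ventures.HSemireg.Wedge.HankelFrameChange` continued; imports J9, J8, `Mathlib.LinearAlgebra.Eigenspace.Minpoly`) settles it for fields with an element of order `> n`:
* §274 LAGRANGE PROJECTORS: `aeval_apply_mem_of_forall_mem` (a `T`-stable subspace is stable under every polynomial in `T`), `SbC_diag_spikeBasis` (`SbC(a 0 0 d) E_q =
  a^{n−q}d^q • E_q`), `repr_SbC_spikeBasis` (`repr (SbC g E_r) a = S_n(g)_{a,r}`), **`repr_smul_spikeBasis_mem_of_stable`: if `t^0, …, t^n` are pairwise distinct and `W` is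
  stable under the torus element `SbC(1 0 0 t)`, then EVERY SPIKE COMPONENT `(repr w q) • E_q` of every `w ∈ W` lies in `W`** (apply `Π_{q' ≠ q} (T − t^{q'})`), hence
  `exists_spikeBasis_mem_of_stable` (`W ≠ ⊥ ⇒` some `E_q ∈ W`).
* §275 THE CRITERION: **`eq_top_of_torus_shear_swap_stable`: all `C(n,j)` units in `K`, `t` with `n + 1` distinct powers ⇒ every non-zero subspace of `spikeSpan n` stable
  under `SbC(1 0 0 t)`, `SbC(1 1 0 1)` and `SbC(0 1 1 0)` is `⊤`** (from `E_q ∈ W`: the shear puts `C(n,q)•E_n` in, the swap gives `E_0`, the shear of `E_0` has all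
  coordinates `1`), `eq_top_of_forall_SbC_stable_of_choose_ne_zero`; the converse side: the Siegel classes pulled back into `spikeSpan n` (`Submodule.comap` of `coSiegel_n ⊓ SI_n` along
  the inclusion) — `SbC_mem_comap_siegel` (stable, J8), `comap_siegel_ne_top` (proper), `comap_siegel_eq_bot_iff` (`= ⊥ ⇔` all `C(n,j)` units, I19) — and **`forall_stable_eq_top_iff_choose_ne_zero`: with such a `t` in `K`, th-7's class space is IRREDUCIBLE under all
  substitutions IFF every `C(n,j)`, `j ≤ n`, is non-zero in `K`** (with J16: iff `n + 1 = (d+1)·p^k`, `d < p`, in characteristic `p`).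
* §276 FIELDS WITH SUCH A `t`: `exists_pow_injective_of_infinite` (an infinite field has an element with `n + 1` distinct powers: avoid the roots of `X·Π_{d ≤ n}(X^d − 1)`),
  **`forall_stable_eq_top_iff_choose_ne_zero_of_infinite`** (the criterion over every infinite field), `eq_top_of_forall_SbC_stable_of_infinite_of_charZero`.
NOT typed here: finite fields `𝔽_q` with `q ≤ n + 1` (for `n ≥ q` the class space is reducible whatever the binomials — the `q + 1` rational point classes span a proper stable
subspace; next leaf); the identification of the irreducible quotient by the Siegel classes; anything Ext-side.  No definitions; new names only.
-/

open Module

namespace Summit.Ventures.HSemireg.Wedge.HankelFrameChange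

open Summit.Ventures.HSemireg.Wedge Summit.Ventures.HSemireg.Wedge.Kunneth Summit.Ventures.HSemireg.Wedge.Hankel
  Summit.Ventures.HSemireg.Wedge.BasisFree Summit.Ventures.HSemireg.Wedge.HankelSiegel Summit.Ventures.HSemireg.Wedge.HankelSiegelIdeal
  Summit.Ventures.HSemireg.Wedge.KunnethKernel Summit.Ventures.HSemireg.Wedge.HankelRankOne Summit.Ventures.HSemireg.Wedge.KernelDuality

variable (K : Type*) [Field K] {n : ℕ}

/-! ## §274. Lagrange projectors of the torus: every spike component of a torus-stable subspace lies in it -/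

section Stable

variable {V : Type*} [AddCommGroup V] [Module K V]

/-- a `T`-stable subspace is stable under every polynomial in `T`. -/
theorem aeval_apply_mem_of_forall_mem {T : V →ₗ[K] V} {W : Submodule K V} (hT : ∀ v ∈ W, T v ∈ W) (P : Polynomial K) {v : V} (hv : v ∈ W) :
    Polynomial.aeval T P v ∈ W := by
  induction P using Polynomial.induction_on' with
  | add P Q hP hQ => rw [map_add, LinearMap.add_apply]; exact Submodule.add_mem _ hP hQ
  | monomial k c => rw [Polynomial.aeval_monomial, Module.End.mul_apply, Module.algebraMap_end_apply]; exact Submodule.smul_mem _ _ (pow_apply_mem_of_forall_mem K hT hv k)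

end Stable

/-- **the spikes are the weight vectors of the torus: `SbC(a 0 0 d) E_q = a^{n−q} d^q • E_q`** (I4 `Sb_diag_w_spike` on `spikeBasis`). -/
theorem SbC_diag_spikeBasis (a d : K) (q : Fin (n + 1)) : SbC K a 0 0 d (spikeBasis K n q) = (a ^ (n - (q : ℕ)) * d ^ (q : ℕ)) • spikeBasis K n q :=
  Subtype.ext (by rw [SbC_apply_coe, Submodule.coe_smul, spikeBasis_coe]; exact Sb_diag_w_spike K a d (q : ℕ) le_rfl)

/-- the spike coordinates of `SbC g E_r` are the entries of th-7's matrix: `repr (SbC g E_r) a = S_n(g)_{a,r}` (I11 `toMatrix_SbC`). -/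
theorem repr_SbC_spikeBasis (α β γ δ : K) (r a : Fin (n + 1)) : (spikeBasis K n).repr (SbC K α β γ δ (spikeBasis K n r)) a = sbMat K α β γ δ n (n + 1) a r := by
  rw [← LinearMap.toMatrix_apply (spikeBasis K n) (spikeBasis K n), toMatrix_SbC]

/-- the Lagrange projector of the torus at the spike `q`: `Π_{q' ≠ q} (SbC(1 0 0 t) − t^{q'})` maps `E_{q''}` to `(Π_{q' ≠ q} (t^{q''} − t^{q'})) • E_{q''}` — zero unless `q'' = q`. -/
theorem aeval_prod_erase_SbC_diag_spikeBasis [DecidableEq K] (t : K) (q q'' : Fin (n + 1)) :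
    Polynomial.aeval (SbC K 1 0 0 t (n := n)) (∏ q' ∈ Finset.univ.erase q, (Polynomial.X - Polynomial.C (t ^ (q' : ℕ)))) (spikeBasis K n q'') =
      (∏ q' ∈ Finset.univ.erase q, (t ^ (q'' : ℕ) - t ^ (q' : ℕ))) • spikeBasis K n q'' := by
  have hev : Module.End.HasEigenvector (SbC K 1 0 0 t (n := n)) (t ^ (q'' : ℕ)) (spikeBasis K n q'') := by
    refine Module.End.hasEigenvector_iff.mpr ⟨Module.End.mem_eigenspace_iff.mpr ?_, (spikeBasis K n).ne_zero q''⟩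
    rw [SbC_diag_spikeBasis, one_pow, one_mul]
  rw [Module.End.aeval_apply_of_hasEigenvector hev, Polynomial.eval_prod]
  simp only [Polynomial.eval_sub, Polynomial.eval_X, Polynomial.eval_C]

/-- **EVERY SPIKE COMPONENT OF A TORUS-STABLE SUBSPACE LIES IN IT: if `t^0, t^1, …, t^n` are pairwise distinct and `W` is stable under `SbC(1 0 0 t)`, then `(repr w q) • E_q ∈ W`
for every `w ∈ W` and every `q`** (apply the Lagrange projector at `q`, a polynomial in the torus element, and divide by `Π_{q' ≠ q}(t^q − t^{q'}) ≠ 0`). -/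
theorem repr_smul_spikeBasis_mem_of_stable {t : K} (ht : Function.Injective fun q : Fin (n + 1) => t ^ (q : ℕ)) {W : Submodule K (spikeSpan K n)}
    (hW : ∀ f ∈ W, SbC K 1 0 0 t f ∈ W) {w : spikeSpan K n} (hw : w ∈ W) (q : Fin (n + 1)) : (spikeBasis K n).repr w q • spikeBasis K n q ∈ W := by
  classical
  set c : K := ∏ q' ∈ Finset.univ.erase q, (t ^ (q : ℕ) - t ^ (q' : ℕ)) with hc
  have hc0 : c ≠ 0 := Finset.prod_ne_zero_iff.mpr fun q' hq' => sub_ne_zero.mpr fun e => (Finset.mem_erase.mp hq').1 (ht e).symm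
  have hmem := aeval_apply_mem_of_forall_mem K hW (∏ q' ∈ Finset.univ.erase q, (Polynomial.X - Polynomial.C (t ^ (q' : ℕ)))) hw
  have hval : Polynomial.aeval (SbC K 1 0 0 t (n := n)) (∏ q' ∈ Finset.univ.erase q, (Polynomial.X - Polynomial.C (t ^ (q' : ℕ)))) w =
      ((spikeBasis K n).repr w q * c) • spikeBasis K n q := by
    conv_lhs => rw [← (spikeBasis K n).sum_repr w]
    rw [map_sum, Finset.sum_eq_single q (fun q'' _ hq'' => ?_) (fun h => absurd (Finset.mem_univ q) h)]
    · rw [map_smul, aeval_prod_erase_SbC_diag_spikeBasis, smul_smul]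
    · rw [map_smul, aeval_prod_erase_SbC_diag_spikeBasis, Finset.prod_eq_zero (Finset.mem_erase.mpr ⟨hq'', Finset.mem_univ _⟩) (sub_self _), zero_smul, smul_zero]
  rw [hval] at hmem
  have h := Submodule.smul_mem W c⁻¹ hmem
  rwa [smul_smul, mul_comm ((spikeBasis K n).repr w q) c, ← mul_assoc, inv_mul_cancel₀ hc0, one_mul] at h

/-- hence **a non-zero torus-stable subspace contains a spike `E_q`** (`t` with `n + 1` distinct powers). -/
theorem exists_spikeBasis_mem_of_stable {t : K} (ht : Function.Injective fun q : Fin (n + 1) => t ^ (q : ℕ)) {W : Submodule K (spikeSpan K n)}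
    (hW : ∀ f ∈ W, SbC K 1 0 0 t f ∈ W) (hW0 : W ≠ ⊥) : ∃ q : Fin (n + 1), spikeBasis K n q ∈ W := by
  obtain ⟨w, hw, hw0⟩ := (Submodule.ne_bot_iff W).mp hW0
  obtain ⟨q, hq⟩ : ∃ q, (spikeBasis K n).repr w q ≠ 0 := by
    by_contra h
    push Not at h
    exact hw0 ((spikeBasis K n).repr.map_eq_zero_iff.mp (Finsupp.ext h))
  refine ⟨q, ?_⟩
  have h := Submodule.smul_mem W ((spikeBasis K n).repr w q)⁻¹ (repr_smul_spikeBasis_mem_of_stable K ht hW hw q)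
  rwa [smul_smul, inv_mul_cancel₀ hq, one_smul] at h

/-! ## §275. The criterion -/

/-- the point class `E_n` and the pure class `E_0` as vectors of th-7's spike basis. -/
theorem spikeBasis_last_eq : spikeBasis K n (Fin.last n) = ⟨w K n n (fun j => if j = n then (1 : K) else 0), w_mem_spikeSpan K _⟩ :=
  Subtype.ext (by rw [spikeBasis_coe]; rfl)

/-- `E_0` as a vector of th-7's spike basis. -/
theorem spikeBasis_zero_eq : spikeBasis K n 0 = ⟨w K n n (fun j => if j = 0 then (1 : K) else 0), w_mem_spikeSpan K _⟩ :=
  Subtype.ext (by rw [spikeBasis_coe]; rfl)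

/-- **THE CRITERION («IF»): all `C(n,j)` units in `K` and `t ∈ K` with `t^0, …, t^n` pairwise distinct ⇒ every non-zero subspace of th-7's class space stable under the torus
element `SbC(1 0 0 t)`, the shear `SbC(1 1 0 1)` and the swap `SbC(0 1 1 0)` is `⊤`** — from some `E_q ∈ W` (§274): the shear puts `Σ_a C(a,q) E_a` in `W`, whose `E_n`-component
`C(n,q) • E_n` lies in `W` (§274), so `E_n ∈ W`; the swap gives `E_0 ∈ W`; the shear of `E_0` is `Σ_a E_a`, all of whose components lie in `W`. -/
theorem eq_top_of_torus_shear_swap_stable (hbin : ∀ j ≤ n, ((n.choose j : ℕ) : K) ≠ 0) {t : K} (ht : Function.Injective fun q : Fin (n + 1) => t ^ (q : ℕ))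
    {W : Submodule K (spikeSpan K n)} (hD : ∀ f ∈ W, SbC K 1 0 0 t f ∈ W) (hU : ∀ f ∈ W, SbC K 1 1 0 1 f ∈ W) (hS : ∀ f ∈ W, SbC K 0 1 1 0 f ∈ W) (hW : W ≠ ⊥) :
    W = ⊤ := by
  obtain ⟨q, hq⟩ := exists_spikeBasis_mem_of_stable K ht hD hW
  -- the point class: the `E_n`-component of `SbC(1 1 0 1) E_q` is `C(n,q) • E_n`
  have hn : spikeBasis K n (Fin.last n) ∈ W := by
    have h := repr_smul_spikeBasis_mem_of_stable K ht hD (hU _ hq) (Fin.last n)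
    rw [repr_SbC_spikeBasis, sbMat_shear_apply, if_pos (by rw [Fin.val_last]; exact Nat.le_of_lt_succ q.2), one_pow, mul_one, Fin.val_last] at h
    have h' := Submodule.smul_mem W (((n.choose (q : ℕ) : ℕ) : K))⁻¹ h
    rwa [smul_smul, inv_mul_cancel₀ (hbin q (Nat.le_of_lt_succ q.2)), one_smul] at h'
  -- the pure class, by the swap
  have h0 : spikeBasis K n 0 ∈ W := by
    rw [spikeBasis_zero_eq, ← SbC_swap_spike_top, ← spikeBasis_last_eq]
    exact hS _ hn
  -- every spike: the `E_a`-component of `SbC(1 1 0 1) E_0` is `E_a`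
  rw [eq_top_iff, ← (spikeBasis K n).span_eq, Submodule.span_le]
  rintro _ ⟨a, rfl⟩
  have h := repr_smul_spikeBasis_mem_of_stable K ht hD (hU _ h0) a
  rw [repr_SbC_spikeBasis, sbMat_shear_apply, Fin.val_zero, if_pos (Nat.zero_le _), Nat.choose_zero_right, Nat.cast_one, one_pow, mul_one, one_smul] at h
  exact h

/-- **hence, under the same hypotheses, every non-zero subspace stable under ALL substitutions `SbC g` is `⊤`.** -/
theorem eq_top_of_forall_SbC_stable_of_choose_ne_zero (hbin : ∀ j ≤ n, ((n.choose j : ℕ) : K) ≠ 0) {t : K} (ht : Function.Injective fun q : Fin (n + 1) => t ^ (q : ℕ))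
    {W : Submodule K (spikeSpan K n)} (hall : ∀ α β γ δ : K, ∀ f ∈ W, SbC K α β γ δ f ∈ W) (hW : W ≠ ⊥) : W = ⊤ :=
  eq_top_of_torus_shear_swap_stable K hbin ht (hall 1 0 0 t) (hall 1 1 0 1) (hall 0 1 1 0) hW

/-- **the Siegel classes, pulled back into th-7's class space (`comap` of `coSiegel_n ⊓ SI_n` along the inclusion), are stable under every substitution** (J8). -/
theorem SbC_mem_comap_siegel (α β γ δ : K) {f : spikeSpan K n} (hf : f ∈ Submodule.comap (spikeSpan K n).subtype (coSiegel K n n ⊓ siegelIdeal K n n)) :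
    SbC K α β γ δ f ∈ Submodule.comap (spikeSpan K n).subtype (coSiegel K n n ⊓ siegelIdeal K n n) :=
  Sb_mem_coSiegel_inf_siegelIdeal K α β γ δ hf

/-- they are a PROPER subspace of the class space (`E_0` is not a Siegel form). -/
theorem comap_siegel_ne_top : Submodule.comap (spikeSpan K n).subtype (coSiegel K n n ⊓ siegelIdeal K n n) ≠ ⊤ := by
  intro h
  have h0 : spikeBasis K n 0 ∈ Submodule.comap (spikeSpan K n).subtype (coSiegel K n n ⊓ siegelIdeal K n n) := by rw [h]; exact Submodule.mem_top
  rw [Submodule.mem_comap, Submodule.subtype_apply, spikeBasis_zero_eq] at h0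
  exact w_spike_zero_not_mem_siegelIdeal K h0.2

/-- **they vanish iff every `C(n,j)` is a unit in `K`** (I19 `coSiegel_inf_siegelIdeal_eq_bot_iff`, pulled back: `coSiegel_n ⊓ SI_n ≤ spikeSpan n`). -/
theorem comap_siegel_eq_bot_iff : Submodule.comap (spikeSpan K n).subtype (coSiegel K n n ⊓ siegelIdeal K n n) = ⊥ ↔ ∀ j ≤ n, ((n.choose j : ℕ) : K) ≠ 0 := by
  rw [← coSiegel_inf_siegelIdeal_eq_bot_iff]
  constructor
  · intro h
    rw [eq_bot_iff]
    intro θ hθ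
    have hθ' : (⟨θ, by rw [spikeSpan_eq_coSiegel]; exact hθ.1⟩ : spikeSpan K n) ∈ Submodule.comap (spikeSpan K n).subtype (coSiegel K n n ⊓ siegelIdeal K n n) := hθ
    rw [h, Submodule.mem_bot] at hθ'
    exact (Submodule.mem_bot K).mpr (congrArg Subtype.val hθ')
  · intro h
    rw [h, Submodule.comap_bot, Submodule.ker_subtype]

/-- **THE SHARP CRITERION: over a field containing `t` with `t^0, …, t^n` pairwise distinct, th-7's class space is IRREDUCIBLE under the substitutions (every non-zero
subspace stable under all `SbC g` is `⊤`) IFF every `C(n,j)`, `j ≤ n`, is non-zero in `K`** («only if»: otherwise the Siegel classes are a proper non-zero stable subspace;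
with J16: in characteristic `p` iff `n + 1 = (d+1)·p^k` with `d < p`). -/
theorem forall_stable_eq_top_iff_choose_ne_zero {t : K} (ht : Function.Injective fun q : Fin (n + 1) => t ^ (q : ℕ)) :
    (∀ W : Submodule K (spikeSpan K n), (∀ α β γ δ : K, ∀ f ∈ W, SbC K α β γ δ f ∈ W) → W ≠ ⊥ → W = ⊤) ↔ ∀ j ≤ n, ((n.choose j : ℕ) : K) ≠ 0 := by
  constructor
  · intro h
    by_contra hbin
    exact comap_siegel_ne_top K (h _ (fun α β γ δ f hf => SbC_mem_comap_siegel K α β γ δ hf) (fun hb => hbin ((comap_siegel_eq_bot_iff K).mp hb)))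
  · intro hbin W hall hW
    exact eq_top_of_forall_SbC_stable_of_choose_ne_zero K hbin ht hall hW

/-! ## §276. Fields with an element of order `> n`: every infinite field -/

omit [Field K] in
/-- **an infinite field contains `t` with `t^0, t^1, …, t^n` pairwise distinct** (avoid `0` and the roots of `X^d − 1`, `1 ≤ d ≤ n`: finitely many). -/
theorem exists_pow_injective_of_infinite (K : Type*) [Field K] [Infinite K] (n : ℕ) : ∃ t : K, Function.Injective fun q : Fin (n + 1) => t ^ (q : ℕ) := by
  classical
  -- the bad set: `0` and the `d`-th roots of unity, `1 ≤ d ≤ n`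
  let P : Polynomial K := Polynomial.X * ∏ d ∈ Finset.Icc 1 n, (Polynomial.X ^ d - 1)
  have hP : P ≠ 0 := mul_ne_zero Polynomial.X_ne_zero (Finset.prod_ne_zero_iff.mpr fun d hd =>
    Polynomial.X_pow_sub_C_ne_zero (Finset.mem_Icc.mp hd).1 1)
  obtain ⟨t, ht⟩ := Infinite.exists_notMem_finset P.roots.toFinset
  rw [Multiset.mem_toFinset, Polynomial.mem_roots hP, Polynomial.IsRoot.def, Polynomial.eval_mul, Polynomial.eval_X, Polynomial.eval_prod, mul_eq_zero, not_or,
    Finset.prod_eq_zero_iff, not_exists] at ht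
  obtain ⟨ht0, htd⟩ := ht
  refine ⟨t, fun i j e => ?_⟩
  change t ^ (i : ℕ) = t ^ (j : ℕ) at e
  by_contra hij
  -- wlog `i < j`; then `t^{j-i} = 1` with `1 ≤ j - i ≤ n`
  rcases lt_or_gt_of_ne (fun h : (i : ℕ) = (j : ℕ) => hij (Fin.ext h)) with hlt | hlt
  · refine htd ((j : ℕ) - (i : ℕ)) ⟨Finset.mem_Icc.mpr ⟨by omega, by omega⟩, ?_⟩
    rw [Polynomial.eval_sub, Polynomial.eval_pow, Polynomial.eval_X, Polynomial.eval_one, sub_eq_zero]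
    have h := congrArg (fun x => x * (t ^ (i : ℕ))⁻¹) e
    simp only [mul_inv_cancel₀ (pow_ne_zero _ ht0)] at h
    rw [← pow_sub₀ t ht0 hlt.le] at h
    exact h.symm
  · refine htd ((i : ℕ) - (j : ℕ)) ⟨Finset.mem_Icc.mpr ⟨by omega, by omega⟩, ?_⟩
    rw [Polynomial.eval_sub, Polynomial.eval_pow, Polynomial.eval_X, Polynomial.eval_one, sub_eq_zero]
    have h := congrArg (fun x => x * (t ^ (j : ℕ))⁻¹) e
    simp only [mul_inv_cancel₀ (pow_ne_zero _ ht0)] at h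
    rw [← pow_sub₀ t ht0 hlt.le] at h
    exact h

/-- **OVER EVERY INFINITE FIELD: th-7's class space is irreducible under the substitutions IFF every `C(n,j)` is non-zero in `K`.** -/
theorem forall_stable_eq_top_iff_choose_ne_zero_of_infinite [Infinite K] :
    (∀ W : Submodule K (spikeSpan K n), (∀ α β γ δ : K, ∀ f ∈ W, SbC K α β γ δ f ∈ W) → W ≠ ⊥ → W = ⊤) ↔ ∀ j ≤ n, ((n.choose j : ℕ) : K) ≠ 0 := by
  obtain ⟨t, ht⟩ := exists_pow_injective_of_infinite K n
  exact forall_stable_eq_top_iff_choose_ne_zero K ht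

/-- in particular in characteristic `0` (J9/J12 re-derived through the torus, for infinite `K`): every non-zero subspace stable under all substitutions is `⊤`. -/
theorem eq_top_of_forall_SbC_stable_of_infinite_of_charZero [Infinite K] [CharZero K] {W : Submodule K (spikeSpan K n)}
    (hall : ∀ α β γ δ : K, ∀ f ∈ W, SbC K α β γ δ f ∈ W) (hW : W ≠ ⊥) : W = ⊤ :=
  (forall_stable_eq_top_iff_choose_ne_zero_of_infinite K).mpr (fun _ hj => Nat.cast_ne_zero.mpr (Nat.choose_pos hj).ne') W hall hW

end Summit.Ventures.HSemireg.Wedge.HankelFrameChange
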